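import Literature.Analysis.FluidPDE.AdaptedBackwardKernel
import HarnessLib

/-!
# Concentration at the pole from a Gaussian upper bound and unit mass
# (route `AdaptedFrequency`, item `TangentFlowTransfer`, stmt-NavierStokesRegularity-10494)

Helper file (all results proved). In the Type-I compactness transfer `TangentFlowTransfer` the
adapted kernel `K` of the tangent flow is obtained as a locally uniform limit of zoomed kernels
`G_{c_k}`; four of its five clauses (regularity, positivity, adjoint equation, unit mass) and the
two-sided Gaussian comparability pass to such limits directly, but the fifth clause —
**concentration** `∫ φ K(t) → φ(x₀)` as `t ↑ T` for bounded continuous `φ` — cannot be obtained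
by exchanging the limits `k → ∞` and `t ↑ T`. This file supplies it from the other clauses:

* `gaussian_eq_const_mul_backwardHeatKernel`: the Gaussian majorant
  `C₁ (T−t)^{-n/2} e^{−‖x−x₀‖²/(C₂(T−t))}` is the constant `C₁ (π C₂)^{n/2}` times the backward heat
  kernel of diffusivity `C₂/4` with pole `(T, x₀)` (`Literature.Analysis.FluidPDE.backwardHeatKernel`);
* `tendsto_integral_mul_of_gaussian_upper`: **if `0 ≤ K(t, ·) ≤ C₁ (T−t)^{-n/2} e^{−‖·−x₀‖²/(C₂(T−t))}`
  and `∫ K(t, ·) = 1` for all `t < T` near `T`, then `∫ φ K(t, ·) → φ(x₀)` as `t ↑ T`** for every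
  bounded continuous `φ`: `|∫ φ K(t) − φ(x₀)| ≤ ∫ |φ − φ(x₀)| K(t) ≤ C ∫ |φ − φ(x₀)| Γ(t) → C · 0` by
  the concentration of the heat kernel itself (the tree's
  `Literature.Analysis.FluidPDE.tendsto_integral_mul_backwardHeatKernel`, Evans 2010 §2.3.1 Thm 1);
* `tendsto_integral_mul_of_gaussian_upper_Iio`: the form consumed by the item (clauses quantified
  over `t ∈ Iio T`, the Gaussian constants as in the route's inline comparability clause on `ℝ³`).

References: L. C. Evans, *Partial Differential Equations*, 2nd ed. (2010), §2.3.1 Thm 1 (c);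
D. G. Aronson, Bull. AMS 73 (1967), Thm 1 (Gaussian bounds for fundamental solutions).
-/

noncomputable section

open MeasureTheory Set Function Filter TopologicalSpace Metric
open scoped Topology NNReal ENNReal

namespace Summit.NavierStokesRegularity.NavierStokesRegularity.Theorems

open Literature.Analysis Literature.Analysis.FluidPDE

variable {E : Type*} [NormedAddCommGroup E] [InnerProductSpace ℝ E] [FiniteDimensional ℝ E]
  [MeasurableSpace E] [BorelSpace E]

omit [FiniteDimensional ℝ E] [MeasurableSpace E] [BorelSpace E] in
/-- **The Gaussian majorant is a multiple of a backward heat kernel**: for `t < T`, `C₂ > 0`,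
`C₁ (T−t)^{-n/2} e^{−‖x−x₀‖²/(C₂(T−t))} = C₁ (π C₂)^{n/2} · Γ_{C₂/4}(t, x; T, x₀)`, where
`Γ_ν(t, x; T, x₀) = (4πν(T−t))^{-n/2} e^{−‖x−x₀‖²/(4ν(T−t))}` is the backward heat kernel
(`backwardHeatKernel_eq`). [folklore] -/
theorem gaussian_eq_const_mul_backwardHeatKernel {T t : ℝ} (ht : t < T) (x₀ x : E) (C₁ : ℝ)
    {C₂ : ℝ} (hC₂ : 0 < C₂) :
    C₁ * (T - t) ^ (-(Module.finrank ℝ E : ℝ) / 2) * Real.exp (-(‖x - x₀‖ ^ 2) / (C₂ * (T - t))) =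
      (C₁ * (Real.pi * C₂) ^ ((Module.finrank ℝ E : ℝ) / 2)) *
        backwardHeatKernel (C₂ / 4) T x₀ t x := by
  set n := Module.finrank ℝ E with hn
  have hν : (0 : ℝ) ≤ C₂ / 4 := by positivity
  rw [backwardHeatKernel_eq hν x₀ ht x]
  have h4 : 4 * Real.pi * (C₂ / 4) = Real.pi * C₂ := by ring
  have h4' : 4 * (C₂ / 4) * (T - t) = C₂ * (T - t) := by ring
  rw [h4, h4']
  have hpc : 0 < Real.pi * C₂ := by positivity
  have hcancel : (Real.pi * C₂) ^ ((n : ℝ) / 2) * (Real.pi * C₂) ^ (-(n : ℝ) / 2) = 1 := by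
    rw [neg_div, Real.rpow_neg hpc.le, mul_inv_cancel₀ (Real.rpow_pos_of_pos hpc _).ne']
  calc C₁ * (T - t) ^ (-(n : ℝ) / 2) * Real.exp (-(‖x - x₀‖ ^ 2) / (C₂ * (T - t)))
      = C₁ * ((Real.pi * C₂) ^ ((n : ℝ) / 2) * (Real.pi * C₂) ^ (-(n : ℝ) / 2)) *
          (T - t) ^ (-(n : ℝ) / 2) * Real.exp (-(‖x - x₀‖ ^ 2) / (C₂ * (T - t))) := by
        rw [hcancel, mul_one]
    _ = C₁ * (Real.pi * C₂) ^ ((n : ℝ) / 2) * ((Real.pi * C₂) ^ (-(n : ℝ) / 2) *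
          (T - t) ^ (-(n : ℝ) / 2) * Real.exp (-(‖x - x₀‖ ^ 2) / (C₂ * (T - t)))) := by ring

/-- The backward heat kernel slice `Γ(t, ·)`, `t < T`, is integrable (the tree's
`integrable_heatKernel_holds`, translated). [folklore] -/
theorem integrable_backwardHeatKernel {ν T t : ℝ} (hν : 0 < ν) (ht : t < T) (x₀ : E) :
    Integrable (backwardHeatKernel ν T x₀ t) (volume : Measure E) := by
  have hσ : 0 < ν * (T - t) := mul_pos hν (sub_pos.2 ht)
  have h := (UnboundedOperators.integrable_heatKernel_holds (E := E) hσ).comp_sub_right x₀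
  exact h

/-- A slice of unit mass is integrable (otherwise its Bochner integral would be the junk value
`0 ≠ 1`). [folklore] -/
theorem integrable_of_integral_eq_one {g : E → ℝ} (h : ∫ x, g x = 1) :
    Integrable g (volume : Measure E) := by
  by_contra hg
  rw [integral_undef hg] at h
  exact zero_ne_one h

/-- **Concentration at the pole from a Gaussian upper bound and unit mass.** Let `K : ℝ → E → ℝ`
satisfy, for all `t < T` close to `T`: `0 ≤ K(t, x) ≤ C₁ (T−t)^{-n/2} e^{−‖x−x₀‖²/(C₂(T−t))}`
(`C₂ > 0`, `n = dim E`) and `∫ K(t, x) dx = 1`. Then for every bounded continuous `φ : E → ℝ`,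
`∫ φ(x) K(t, x) dx → φ(x₀)` as `t ↑ T`. Proof: `∫ φ K(t) − φ(x₀) = ∫ (φ − φ(x₀)) K(t)` by unit mass,
`|∫ (φ − φ(x₀)) K(t)| ≤ ∫ |φ − φ(x₀)| K(t) ≤ C₁ (πC₂)^{n/2} ∫ |φ − φ(x₀)| Γ_{C₂/4}(t)`, and the last
integral tends to `|φ(x₀) − φ(x₀)| = 0` by the concentration of the heat kernel
(`tendsto_integral_mul_backwardHeatKernel`; Evans 2010, §2.3.1 Thm 1 (c)). [folklore] -/
theorem tendsto_integral_mul_of_gaussian_upper {K : ℝ → E → ℝ} {T : ℝ} {x₀ : E} {C₁ C₂ : ℝ}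
    (hC₂ : 0 < C₂)
    (hK : ∀ᶠ t in 𝓝[<] T, (∀ x, 0 ≤ K t x) ∧
      (∀ x, K t x ≤ C₁ * (T - t) ^ (-(Module.finrank ℝ E : ℝ) / 2) *
        Real.exp (-(‖x - x₀‖ ^ 2) / (C₂ * (T - t)))) ∧ ∫ x, K t x = 1)
    {φ : E → ℝ} (hφ : Continuous φ) (hφb : ∃ M : ℝ, ∀ x, |φ x| ≤ M) :
    Tendsto (fun t => ∫ x, φ x * K t x) (𝓝[<] T) (𝓝 (φ x₀)) := by
  obtain ⟨M, hM⟩ := hφb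
  set n := Module.finrank ℝ E with hn
  set A : ℝ := C₁ * (Real.pi * C₂) ^ ((n : ℝ) / 2) with hA
  set Γ : ℝ → E → ℝ := backwardHeatKernel (C₂ / 4) T x₀ with hΓ
  set ψ : E → ℝ := fun x => |φ x - φ x₀| with hψ
  have hν : (0 : ℝ) < C₂ / 4 := by positivity
  have hψc : Continuous ψ := (hφ.sub continuous_const).abs
  have hψb : ∀ x, |ψ x| ≤ 2 * |M| := fun x => by
    rw [hψ]; dsimp only; rw [abs_abs]
    calc |φ x - φ x₀| ≤ |φ x| + |φ x₀| := abs_sub _ _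
      _ ≤ |M| + |M| := add_le_add ((hM x).trans (le_abs_self M)) ((hM x₀).trans (le_abs_self M))
      _ = 2 * |M| := by ring
  have hψ0 : ∀ x, 0 ≤ ψ x := fun x => abs_nonneg _
  -- the heat-kernel side tends to `ψ x₀ = 0`
  have hheat : Tendsto (fun t => A * ∫ x, ψ x * Γ t x) (𝓝[<] T) (𝓝 0) := by
    have h := tendsto_integral_mul_backwardHeatKernel hν T x₀ hψc hψb
    have h0 : ψ x₀ = 0 := by simp [hψ]
    rw [h0] at h
    simpa using h.const_mul A
  -- the difference is dominated by the heat-kernel side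
  have hφm : AEStronglyMeasurable φ (volume : Measure E) := hφ.aestronglyMeasurable
  have hψm : AEStronglyMeasurable ψ (volume : Measure E) := hψc.aestronglyMeasurable
  have hbound : ∀ᶠ t in 𝓝[<] T, ‖(∫ x, φ x * K t x) - φ x₀‖ ≤ A * ∫ x, ψ x * Γ t x := by
    filter_upwards [hK, self_mem_nhdsWithin] with t ht htT
    obtain ⟨hK0, hKup, hK1⟩ := ht
    have htT' : t < T := htT
    have hKi : Integrable (K t) := integrable_of_integral_eq_one hK1
    have hΓi : Integrable (Γ t) := integrable_backwardHeatKernel hν htT' x₀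
    -- pointwise domination of `K t` by `A * Γ t`
    have hKΓ : ∀ x, K t x ≤ A * Γ t x := fun x => by
      have := hKup x
      rwa [gaussian_eq_const_mul_backwardHeatKernel htT' x₀ x C₁ hC₂] at this
    -- integrability of the products
    have hφK : Integrable (fun x => φ x * K t x) :=
      (hKi.bdd_mul (c := M) hφm (Eventually.of_forall fun x => by
        rw [Real.norm_eq_abs]; exact hM x))
    have hψK : Integrable (fun x => ψ x * K t x) :=
      (hKi.bdd_mul (c := 2 * |M|) hψm (Eventually.of_forall fun x => by
        rw [Real.norm_eq_abs]; exact hψb x))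
    have hψΓ : Integrable (fun x => ψ x * (A * Γ t x)) := by
      have := ((hΓi.const_mul A).bdd_mul (c := 2 * |M|) hψm (Eventually.of_forall fun x => by
        rw [Real.norm_eq_abs]; exact hψb x))
      exact this
    -- `∫ φ K − φ x₀ = ∫ (φ − φ x₀) K`
    have hdiff : (∫ x, φ x * K t x) - φ x₀ = ∫ x, (φ x - φ x₀) * K t x := by
      have h1 : ∫ x, (φ x - φ x₀) * K t x = (∫ x, φ x * K t x) - ∫ x, φ x₀ * K t x := by
        rw [← integral_sub hφK (hKi.const_mul (φ x₀))]
        refine integral_congr_ae (Eventually.of_forall fun x => ?_)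
        ring
      rw [h1, integral_const_mul, hK1, mul_one]
    rw [hdiff, Real.norm_eq_abs]
    -- `|∫ (φ − φ x₀) K| ≤ ∫ ψ K ≤ ∫ ψ (A Γ) = A ∫ ψ Γ`
    calc |∫ x, (φ x - φ x₀) * K t x| ≤ ∫ x, |(φ x - φ x₀) * K t x| := abs_integral_le_integral_abs
      _ = ∫ x, ψ x * K t x := by
          refine integral_congr_ae (Eventually.of_forall fun x => ?_)
          simp only [hψ, abs_mul, abs_of_nonneg (hK0 x)]
      _ ≤ ∫ x, ψ x * (A * Γ t x) :=
          integral_mono hψK hψΓ fun x => mul_le_mul_of_nonneg_left (hKΓ x) (hψ0 x)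
      _ = A * ∫ x, ψ x * Γ t x := by
          rw [← integral_const_mul]
          refine integral_congr_ae (Eventually.of_forall fun x => ?_)
          simp only; ring
  have hzero : Tendsto (fun t => (∫ x, φ x * K t x) - φ x₀) (𝓝[<] T) (𝓝 0) :=
    squeeze_zero_norm' hbound hheat
  have := hzero.add_const (φ x₀)
  simpa using this

/-- **The form consumed by `TangentFlowTransfer`**: if `K : ℝ → E → ℝ` is nonnegative, of unit
mass and bounded above by a Gaussian `C₁ (T−t)^{-n/2} e^{−‖x−x₀‖²/(C₂(T−t))}` for every `t < T`
(`C₂ > 0`), then `K(t, ·) dx ⇀ δ_{x₀}` as `t ↑ T` against bounded continuous test functions —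
clause (5) of `Literature.Analysis.FluidPDE.IsAdaptedBackwardKernel` for the limit kernel of a
blow-up sequence, which inherits positivity, the Gaussian bounds and the unit mass from the
sequence but not, directly, the concentration. [folklore] -/
theorem tendsto_integral_mul_of_gaussian_upper_Iio {K : ℝ → E → ℝ} {T : ℝ} {x₀ : E} {C₁ C₂ : ℝ}
    (hC₂ : 0 < C₂) (hK0 : ∀ t ∈ Iio T, ∀ x, 0 ≤ K t x)
    (hKup : ∀ t ∈ Iio T, ∀ x, K t x ≤ C₁ * (T - t) ^ (-(Module.finrank ℝ E : ℝ) / 2) *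
      Real.exp (-(‖x - x₀‖ ^ 2) / (C₂ * (T - t))))
    (hK1 : ∀ t ∈ Iio T, ∫ x, K t x = 1) :
    ∀ φ : E → ℝ, Continuous φ → (∃ M : ℝ, ∀ x, |φ x| ≤ M) →
      Tendsto (fun t => ∫ x, φ x * K t x) (𝓝[<] T) (𝓝 (φ x₀)) := by
  intro φ hφ hφb
  refine tendsto_integral_mul_of_gaussian_upper (C₁ := C₁) hC₂ ?_ hφ hφb
  filter_upwards [self_mem_nhdsWithin] with t ht
  exact ⟨hK0 t ht, hKup t ht, hK1 t ht⟩

/-- The `ℝ³` specialisation with the route's inline exponent `−3/2` and pole `(0, 0)`: a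
nonnegative unit-mass kernel on `(−∞, 0)` below `C₁ (0−t)^{-3/2} e^{−‖x−0‖²/(C₂(0−t))}`
concentrates at the origin as `t ↑ 0`. [folklore] -/
theorem tendsto_integral_mul_of_gaussian_upper_fin_three
    {K : ℝ → EuclideanSpace ℝ (Fin 3) → ℝ} {C₁ C₂ : ℝ} (hC₂ : 0 < C₂)
    (hK0 : ∀ t ∈ Iio (0 : ℝ), ∀ x, 0 ≤ K t x)
    (hKup : ∀ t ∈ Iio (0 : ℝ), ∀ x, K t x ≤ C₁ * ((0 : ℝ) - t) ^ (-(3 : ℝ) / 2) *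
      Real.exp (-(‖x - (0 : EuclideanSpace ℝ (Fin 3))‖ ^ 2) / (C₂ * ((0 : ℝ) - t))))
    (hK1 : ∀ t ∈ Iio (0 : ℝ), ∫ x, K t x = 1) :
    ∀ φ : EuclideanSpace ℝ (Fin 3) → ℝ, Continuous φ → (∃ M : ℝ, ∀ x, |φ x| ≤ M) →
      Tendsto (fun t => ∫ x, φ x * K t x) (𝓝[<] (0 : ℝ))
        (𝓝 (φ (0 : EuclideanSpace ℝ (Fin 3)))) := by
  refine tendsto_integral_mul_of_gaussian_upper_Iio (C₁ := C₁) hC₂ hK0 (fun t ht x => ?_) hK1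
  have h := hKup t ht x
  simpa only [finrank_euclideanSpace_fin, Nat.cast_ofNat] using h

end Summit.NavierStokesRegularity.NavierStokesRegularity.Theorems

end
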